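import Summits.CriticalPhenomena.Ising3DConformalLimit.Theses.FKParityRobustness
import Summits.CriticalPhenomena.Ising3DConformalLimit.Theorems.ParityRobustMerging.Negative.HWorld
import Literature.Probability.LatticeModels.CriticalTwoPointLower
import HarnessLib

/-!
# `IndependentStrandsJoin` (item stmt-CriticalPhenomena-14625): no graph-uniform constant

Negative knowledge about the crux
`Summit.CriticalPhenomena.Ising3DConformalLimit.Theses.FKParityRobustness.IndependentStrandsJoin`
(standing crux disprover, cycle 1, D-0016).  The crux asks for ONE `c > 0` with
`c·Z(a₀a₁)·Z(a₂a₃) ≤ Σ_{F₁ ∈ 𝒯(a₀a₁)} Σ_{F₂ ∈ 𝒯(a₂a₃)} t^{|F₁|+|F₂|}·1[a₀ ↔ a₂ in F₁ ∪ F₂]` on the boxes of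
`ℤ³` at `t = tanh β_c(3)`.  Its natural GRAPH-UNIFORM strengthening (one constant for every finite graph
and every injective source map — the generality in which the route's supports `StrandsJoinBound` and
`DepletionBound` hold) is FALSE:

* `not_graphUniformStrandsJoin_at` — for every `t > 0`, on the connected path `0 – 1 – 2 – 3` with sources
  `(a₀,a₁,a₂,a₃) = (0,1,2,3)` parity at the leaves expels the middle edge from every `T`-join of `{0,1}`
  and of `{2,3}`, so the joint sum vanishes while `Z(01), Z(23) ≥ t > 0`;
* `not_graphUniformStrandsJoin` — the same at the crux's weight `t_c = tanh β_c(3) > 0`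
  (`criticalBeta_pos_holds`).

Moral: any proof of the crux must use the geometry of `Λ_N ⊂ ℤ³` (interleaved source pairs at one
scale, fat strands), not only finiteness and the graph-uniform identities.  Theorem-only file, no
notation: the path's edge set is written out as `({s(0,1), s(1,2), s(2,3)} : Finset (Sym2 (Fin 4)))`.
-/

noncomputable section

namespace Summit.CriticalPhenomena.Ising3DConformalLimit.IndependentStrandsJoinNegative

open Finset
open Literature.Probability.LatticeModels
open Summit.CriticalPhenomena.Ising3DConformalLimit.ParityRobustMergingNegative (mem_of_reachable_of_closed)
open scoped Classical

/-- `Z^A_t(G) = Σ_{F ∈ 𝒯_A(G)} t^{|F|}`: the tree's `loopO1PartitionFunction` as a sum over `tJoins`. [folklore] -/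
theorem loopO1PartitionFunction_eq_sum_tJoins {V : Type*} [Fintype V] [DecidableEq V]
    (G : SimpleGraph V) [DecidableRel G.Adj] (t : ℝ) (A : Finset V) :
    loopO1PartitionFunction G t A = ∑ F ∈ tJoins G Set.univ A, t ^ #F := by
  unfold loopO1PartitionFunction loopO1Weight
  rw [← Finset.sum_filter]
  refine Finset.sum_congr ?_ fun _ _ => rfl
  ext F
  simp only [Finset.mem_filter, Finset.mem_powerset]
  exact ⟨fun h => h.2, fun h => ⟨((mem_tJoins G).1 h).1, h⟩⟩

section PathWorld

/-- The path `0 – 1 – 2 – 3` has no loops. [folklore] -/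
theorem pathEdges_not_isDiag : ∀ e ∈ ({s(0,1), s(1,2), s(2,3)} : Finset (Sym2 (Fin 4))), ¬ e.IsDiag := by
  decide

/-- The edge finset of the path graph is its defining finset (for every `Fintype` instance). [folklore] -/
theorem pathGraph_edgeFinset
    {inst : Fintype (SimpleGraph.fromEdgeSet
      ((({s(0,1), s(1,2), s(2,3)} : Finset (Sym2 (Fin 4))) : Set (Sym2 (Fin 4))))).edgeSet} :
    @SimpleGraph.edgeFinset (Fin 4) (SimpleGraph.fromEdgeSet
      ((({s(0,1), s(1,2), s(2,3)} : Finset (Sym2 (Fin 4))) : Set (Sym2 (Fin 4))))) inst =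
      ({s(0,1), s(1,2), s(2,3)} : Finset (Sym2 (Fin 4))) := by
  ext e
  rw [SimpleGraph.mem_edgeFinset, SimpleGraph.edgeSet_fromEdgeSet]
  simp only [Set.mem_sdiff, Finset.mem_coe]
  exact ⟨fun h => h.1, fun h => ⟨h, pathEdges_not_isDiag e h⟩⟩

set_option maxRecDepth 20000 in
-- `decide` over the 8 subsets of the edge finset needs a deeper recursion than the default
-- (kernel evaluation of `Finset.powerset`); no linter is disabled.
/-- Parity at the leaf `3` and then at `2` expels the middle edge `12` from every `T`-join of `{0,1}`
inside the path (checked by `decide` over the `8` subsets of the edge set). [folklore] -/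
theorem no12_of_tJoin01 : ∀ F ∈ ({s(0,1), s(1,2), s(2,3)} : Finset (Sym2 (Fin 4))).powerset,
    (∀ v : Fin 4, Odd (F.filter (fun e => v ∈ e)).card ↔ v ∈ ({0, 1} : Finset (Fin 4))) → s(1,2) ∉ F := by
  decide

set_option maxRecDepth 20000 in
-- same justification as `no12_of_tJoin01`
/-- Symmetrically, parity at `0` and then at `1` expels `12` from every `T`-join of `{2,3}`. [folklore] -/
theorem no12_of_tJoin23 : ∀ F ∈ ({s(0,1), s(1,2), s(2,3)} : Finset (Sym2 (Fin 4))).powerset,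
    (∀ v : Fin 4, Odd (F.filter (fun e => v ∈ e)).card ↔ v ∈ ({2, 3} : Finset (Fin 4))) → s(1,2) ∉ F := by
  decide

/-- `{01}` has source set `{0,1}`. [folklore] -/
theorem single01_parity : ∀ v : Fin 4,
    Odd (({s(0,1)} : Finset (Sym2 (Fin 4))).filter (fun e => v ∈ e)).card ↔ v ∈ ({0, 1} : Finset (Fin 4)) := by
  decide

/-- `{23}` has source set `{2,3}`. [folklore] -/
theorem single23_parity : ∀ v : Fin 4,
    Odd (({s(2,3)} : Finset (Sym2 (Fin 4))).filter (fun e => v ∈ e)).card ↔ v ∈ ({2, 3} : Finset (Fin 4)) := by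
  decide

/-- Without the middle edge, `{0,1}` is closed in `F₁ ∪ F₂`, so `0` does not reach `2`. [folklore] -/
theorem path_not_reachable (F₁ F₂ : Finset (Sym2 (Fin 4)))
    (h₁ : F₁ ⊆ ({s(0,1), s(1,2), s(2,3)} : Finset (Sym2 (Fin 4))))
    (h₂ : F₂ ⊆ ({s(0,1), s(1,2), s(2,3)} : Finset (Sym2 (Fin 4))))
    (h12₁ : s(1,2) ∉ F₁) (h12₂ : s(1,2) ∉ F₂) :
    ¬ (SimpleGraph.fromEdgeSet ((↑F₁ : Set (Sym2 (Fin 4))) ∪ ↑F₂)).Reachable 0 2 := by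
  intro h
  have hS : ∀ u v, (SimpleGraph.fromEdgeSet ((↑F₁ : Set (Sym2 (Fin 4))) ∪ ↑F₂)).Adj u v →
      u ∈ (↑({0, 1} : Finset (Fin 4)) : Set (Fin 4)) → v ∈ (↑({0, 1} : Finset (Fin 4)) : Set (Fin 4)) := by
    intro u v huv hu
    rw [SimpleGraph.fromEdgeSet_adj] at huv
    obtain ⟨he, hne⟩ := huv
    have he' : s(u, v) ∈ ({s(0,1), s(1,2), s(2,3)} : Finset (Sym2 (Fin 4))) ∧ s(u, v) ≠ s(1,2) := by
      rcases he with he | he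
      · rw [Finset.mem_coe] at he
        exact ⟨h₁ he, fun h => h12₁ (h ▸ he)⟩
      · rw [Finset.mem_coe] at he
        exact ⟨h₂ he, fun h => h12₂ (h ▸ he)⟩
    rw [Finset.mem_coe] at hu ⊢
    clear he hne h h₁ h₂ h12₁ h12₂
    revert u v
    decide
  have h2 := mem_of_reachable_of_closed hS h (by simp)
  rw [Finset.mem_coe] at h2
  exact absurd h2 (by decide)

/-- **No graph-uniform constant, at ANY edge weight `t > 0`** (the path world).  The crux's inequality
with one constant for all finite graphs and all injective source maps fails on the path `0 – 1 – 2 – 3`: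
the joint sum is `0` (`no12_of_tJoin01`, `no12_of_tJoin23`, `path_not_reachable`) while
`Z(01), Z(23) ≥ t > 0` (`{01} ∈ 𝒯(01)`, `{23} ∈ 𝒯(23)`). [folklore] -/
theorem not_graphUniformStrandsJoin_at {t : ℝ} (ht : 0 < t) :
    ¬ ∃ c : ℝ, 0 < c ∧ ∀ (V : Type) [Fintype V] [DecidableEq V] (G : SimpleGraph V) [DecidableRel G.Adj]
      (a : Fin 4 → V), Function.Injective a →
      c * loopO1PartitionFunction G t {a 0, a 1} * loopO1PartitionFunction G t {a 2, a 3} ≤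
        ∑ F₁ ∈ tJoins G Set.univ {a 0, a 1}, ∑ F₂ ∈ tJoins G Set.univ {a 2, a 3},
          if (SimpleGraph.fromEdgeSet ((↑F₁ : Set (Sym2 V)) ∪ ↑F₂)).Reachable (a 0) (a 2)
            then t ^ (#F₁ + #F₂) else 0 := by
  rintro ⟨c, hc, h⟩
  have key := h (Fin 4) (SimpleGraph.fromEdgeSet ((({s(0,1), s(1,2), s(2,3)} : Finset (Sym2 (Fin 4))) : Set (Sym2 (Fin 4))))) (fun i => i) (fun _ _ h => h)
  have hrhs : (∑ F₁ ∈ tJoins (SimpleGraph.fromEdgeSet ((({s(0,1), s(1,2), s(2,3)} : Finset (Sym2 (Fin 4))) : Set (Sym2 (Fin 4))))) Set.univ ({0, 1} : Finset (Fin 4)),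
      ∑ F₂ ∈ tJoins (SimpleGraph.fromEdgeSet ((({s(0,1), s(1,2), s(2,3)} : Finset (Sym2 (Fin 4))) : Set (Sym2 (Fin 4))))) Set.univ ({2, 3} : Finset (Fin 4)),
        (if (SimpleGraph.fromEdgeSet ((↑F₁ : Set (Sym2 (Fin 4))) ∪ ↑F₂)).Reachable 0 2
          then t ^ (#F₁ + #F₂) else (0 : ℝ))) = 0 := by
    refine Finset.sum_eq_zero fun F₁ hF₁ => Finset.sum_eq_zero fun F₂ hF₂ => ?_
    obtain ⟨hF₁E, -, hpar₁⟩ := (mem_tJoins (SimpleGraph.fromEdgeSet ((({s(0,1), s(1,2), s(2,3)} : Finset (Sym2 (Fin 4))) : Set (Sym2 (Fin 4)))))).1 hF₁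
    obtain ⟨hF₂E, -, hpar₂⟩ := (mem_tJoins (SimpleGraph.fromEdgeSet ((({s(0,1), s(1,2), s(2,3)} : Finset (Sym2 (Fin 4))) : Set (Sym2 (Fin 4)))))).1 hF₂
    rw [pathGraph_edgeFinset] at hF₁E hF₂E
    have h12₁ := no12_of_tJoin01 F₁ (Finset.mem_powerset.2 hF₁E) hpar₁
    have h12₂ := no12_of_tJoin23 F₂ (Finset.mem_powerset.2 hF₂E) hpar₂
    rw [if_neg (path_not_reachable F₁ F₂ hF₁E hF₂E h12₁ h12₂)]
  have hZ01 : t ≤ loopO1PartitionFunction (SimpleGraph.fromEdgeSet ((({s(0,1), s(1,2), s(2,3)} : Finset (Sym2 (Fin 4))) : Set (Sym2 (Fin 4))))) t ({0, 1} : Finset (Fin 4)) := by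
    rw [loopO1PartitionFunction_eq_sum_tJoins]
    have hmem : ({s(0,1)} : Finset (Sym2 (Fin 4))) ∈ tJoins (SimpleGraph.fromEdgeSet ((({s(0,1), s(1,2), s(2,3)} : Finset (Sym2 (Fin 4))) : Set (Sym2 (Fin 4))))) Set.univ ({0, 1} : Finset (Fin 4)) := by
      rw [mem_tJoins, pathGraph_edgeFinset]
      exact ⟨by decide, Set.subset_univ _, single01_parity⟩
    have := Finset.single_le_sum (f := fun F : Finset (Sym2 (Fin 4)) => t ^ #F)
      (fun F _ => pow_nonneg ht.le _) hmem
    simpa using this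
  have hZ23 : t ≤ loopO1PartitionFunction (SimpleGraph.fromEdgeSet ((({s(0,1), s(1,2), s(2,3)} : Finset (Sym2 (Fin 4))) : Set (Sym2 (Fin 4))))) t ({2, 3} : Finset (Fin 4)) := by
    rw [loopO1PartitionFunction_eq_sum_tJoins]
    have hmem : ({s(2,3)} : Finset (Sym2 (Fin 4))) ∈ tJoins (SimpleGraph.fromEdgeSet ((({s(0,1), s(1,2), s(2,3)} : Finset (Sym2 (Fin 4))) : Set (Sym2 (Fin 4))))) Set.univ ({2, 3} : Finset (Fin 4)) := by
      rw [mem_tJoins, pathGraph_edgeFinset]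
      exact ⟨by decide, Set.subset_univ _, single23_parity⟩
    have := Finset.single_le_sum (f := fun F : Finset (Sym2 (Fin 4)) => t ^ #F)
      (fun F _ => pow_nonneg ht.le _) hmem
    simpa using this
  rw [hrhs] at key
  have hpos : 0 < c * loopO1PartitionFunction (SimpleGraph.fromEdgeSet ((({s(0,1), s(1,2), s(2,3)} : Finset (Sym2 (Fin 4))) : Set (Sym2 (Fin 4))))) t ({0, 1} : Finset (Fin 4)) *
      loopO1PartitionFunction (SimpleGraph.fromEdgeSet ((({s(0,1), s(1,2), s(2,3)} : Finset (Sym2 (Fin 4))) : Set (Sym2 (Fin 4))))) t ({2, 3} : Finset (Fin 4)) :=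
    mul_pos (mul_pos hc (ht.trans_le hZ01)) (ht.trans_le hZ23)
  exact absurd key (not_le.mpr hpos)

end PathWorld

/-- `t_c = tanh β_c(3) > 0` (`β_c(3) > 0`, `criticalBeta_pos_holds`). [folklore] -/
theorem tanh_criticalBeta_pos : 0 < Real.tanh (criticalBeta 3) := by
  rw [Real.tanh_eq_sinh_div_cosh]
  exact div_pos (Real.sinh_pos_iff.2 (criticalBeta_pos_holds (d := 3) (by norm_num))) (Real.cosh_pos _)

/-- **No graph-uniform `IndependentStrandsJoin` (natural strengthening of the crux refuted).**  At the
critical weight `t_c = tanh β_c(3)` there is NO constant `c > 0` such that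
`c·Z(a₀a₁)·Z(a₂a₃) ≤ Σ_{F₁ ∈ 𝒯(a₀a₁)} Σ_{F₂ ∈ 𝒯(a₂a₃)} t_c^{|F₁|+|F₂|}·1[a₀ ↔ a₂ in F₁ ∪ F₂]` on every
finite graph with four distinct sources (the path world, `not_graphUniformStrandsJoin_at` with
`tanh_criticalBeta_pos`). [folklore] -/
theorem not_graphUniformStrandsJoin :
    ¬ ∃ c : ℝ, 0 < c ∧ ∀ (V : Type) [Fintype V] [DecidableEq V] (G : SimpleGraph V) [DecidableRel G.Adj]
      (a : Fin 4 → V), Function.Injective a →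
      (let t : ℝ := Real.tanh (criticalBeta 3);
       c * loopO1PartitionFunction G t {a 0, a 1} * loopO1PartitionFunction G t {a 2, a 3} ≤
        ∑ F₁ ∈ tJoins G Set.univ {a 0, a 1}, ∑ F₂ ∈ tJoins G Set.univ {a 2, a 3},
          if (SimpleGraph.fromEdgeSet ((↑F₁ : Set (Sym2 V)) ∪ ↑F₂)).Reachable (a 0) (a 2)
            then t ^ (#F₁ + #F₂) else 0) :=
  not_graphUniformStrandsJoin_at tanh_criticalBeta_pos

end Summit.CriticalPhenomena.Ising3DConformalLimit.IndependentStrandsJoinNegative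

end
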